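import Summits.CriticalPhenomena.PercolationContinuityZ3.Theorems.PercNearOneGluingNoHeavyLowerTailKnQuestion8CoefficientwiseGluing
import Summits.CriticalPhenomena.PercolationContinuityZ3.Theorems.PercNearOneGluingNoHeavyLowerTailKnQuestion8CoefficientwisePendantEdge
import HarnessLib

/-!
# Parallel gluing of clusters at two terminals — prim-lf-2 gen 55

Support file (`--supports stmt-CriticalPhenomena-4575`, closed), prover `prim-lf-2` (gen 55).  No definitions, no named facts, no sorries; standard axioms.
Memo `prim-lf-2/CW-TWOSOURCESYM-gen55.md` §3.6 (bookkeeping for `…CoefficientwiseNoCoreParallelTame.lean`); generalises gen 26's `mem_openCluster_union_parallel`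
(which assumes the second terminal is in neither cluster).
* `Coefficientwise.mem_openCluster_union_parallel_gen` — if an `s₁`-edge and an `s₂`-edge can only share the vertices `x` or `z`, then
  `C_x(s₁ ∪ s₂) = C_x(s₁) ∪ C_x(s₂) ∪ [z ∈ C_x(s₁) ∪ C_x(s₂)]·(C_z(s₁) ∪ C_z(s₂))` (a path from `x` changes sides only at `x` or `z`; closed-set argument).
[cite: KozmaNitzan2024, Questions 8–9 (§5.5 p. 36) (context: the Question-8 pocket covariance programme)]
-/

namespace Summit.CriticalPhenomena.PercolationContinuityZ3.Theorems

open Finset Literature.Probability.Percolation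

namespace Coefficientwise

variable {ι V : Type*} [Fintype ι] [DecidableEq ι]

omit [Fintype ι] in
/-- **Parallel gluing lemma.**  If an `s₁`-edge and an `s₂`-edge can only share the vertices `x` or `z`, then for every `y`:
`y ∈ C_x(s₁ ∪ s₂) ↔ y ∈ C_x(s₁) ∨ y ∈ C_x(s₂) ∨ ((z ∈ C_x(s₁) ∨ z ∈ C_x(s₂)) ∧ (y ∈ C_z(s₁) ∨ y ∈ C_z(s₂)))`.
[cite: KozmaNitzan2024, §5.5 (context only; folklore)] -/
theorem mem_openCluster_union_parallel_gen (ends : ι → Sym2 V) {s₁ s₂ : Finset ι} {x z : V}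
    (hsep : ∀ e ∈ s₁, ∀ e' ∈ s₂, ∀ w : V, w ∈ ends e → w ∈ ends e' → w = x ∨ w = z) (y : V) :
    y ∈ openCluster (ends '' (↑(s₁ ∪ s₂) : Set ι)) x ↔
      (y ∈ openCluster (ends '' (↑s₁ : Set ι)) x ∨ y ∈ openCluster (ends '' (↑s₂ : Set ι)) x ∨
        ((z ∈ openCluster (ends '' (↑s₁ : Set ι)) x ∨ z ∈ openCluster (ends '' (↑s₂ : Set ι)) x) ∧
          (y ∈ openCluster (ends '' (↑s₁ : Set ι)) z ∨ y ∈ openCluster (ends '' (↑s₂ : Set ι)) z))) := by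
  classical
  set K₁ : Set V := openCluster (ends '' (↑s₁ : Set ι)) x with hK₁
  set K₂ : Set V := openCluster (ends '' (↑s₂ : Set ι)) x with hK₂
  set Z₁ : Set V := openCluster (ends '' (↑s₁ : Set ι)) z with hZ₁
  set Z₂ : Set V := openCluster (ends '' (↑s₂ : Set ι)) z with hZ₂
  have mono1 : ∀ {a : V} {w : V}, w ∈ openCluster (ends '' (↑s₁ : Set ι)) a → w ∈ openCluster (ends '' (↑(s₁ ∪ s₂) : Set ι)) a :=
    fun {a} {w} hw => openCluster_image_mono ends Finset.subset_union_left a hw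
  have mono2 : ∀ {a : V} {w : V}, w ∈ openCluster (ends '' (↑s₂ : Set ι)) a → w ∈ openCluster (ends '' (↑(s₁ ∪ s₂) : Set ι)) a :=
    fun {a} {w} hw => openCluster_image_mono ends Finset.subset_union_right a hw
  constructor
  · intro hy
    -- the right-hand side is a closed set containing `x`
    set W : Set V := {w | w ∈ K₁ ∨ w ∈ K₂ ∨ ((z ∈ K₁ ∨ z ∈ K₂) ∧ (w ∈ Z₁ ∨ w ∈ Z₂))} with hW
    have hxW : x ∈ W := Or.inl (mem_openCluster_self _ x)
    -- an `s₁`-step from a vertex of `W` stays in `W`, and symmetrically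
    have step1 : ∀ c d : V, c ∈ W → (openGraph (ends '' (↑s₁ : Set ι))).Adj c d → d ∈ W := by
      intro c d hc hcd
      have hcd' := hcd
      rw [openGraph_image_adj] at hcd'
      obtain ⟨⟨i, hi1, hi⟩, _⟩ := hcd'
      have hci : c ∈ ends i := by rw [hi]; exact Sym2.mem_mk_left c d
      rcases hc with hc | hc | ⟨hz, hc⟩
      · exact Or.inl (SimpleGraph.Reachable.trans hc hcd.reachable)
      · -- `c ∈ K₂`: either `c = x`, or `c` lies on an `s₂`-edge, hence `c = x` or `c = z`
        by_cases hcx : c = x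
        · subst hcx; exact Or.inl hcd.reachable
        · obtain ⟨e', he', hce'⟩ := exists_edge_of_mem_openCluster ends hc hcx
          rcases hsep i hi1 e' he' c hci hce' with h | h
          · exact absurd h hcx
          · subst h
            exact Or.inr (Or.inr ⟨Or.inr hc, Or.inl hcd.reachable⟩)
      · rcases hc with hc | hc
        · exact Or.inr (Or.inr ⟨hz, Or.inl (SimpleGraph.Reachable.trans hc hcd.reachable)⟩)
        · by_cases hcz : c = z
          · subst hcz; exact Or.inr (Or.inr ⟨hz, Or.inl hcd.reachable⟩)
          · obtain ⟨e', he', hce'⟩ := exists_edge_of_mem_openCluster ends hc hcz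
            rcases hsep i hi1 e' he' c hci hce' with h | h
            · subst h; exact Or.inl hcd.reachable
            · exact absurd h hcz
    have step2 : ∀ c d : V, c ∈ W → (openGraph (ends '' (↑s₂ : Set ι))).Adj c d → d ∈ W := by
      intro c d hc hcd
      have hcd' := hcd
      rw [openGraph_image_adj] at hcd'
      obtain ⟨⟨i, hi2, hi⟩, _⟩ := hcd'
      have hci : c ∈ ends i := by rw [hi]; exact Sym2.mem_mk_left c d
      rcases hc with hc | hc | ⟨hz, hc⟩
      · by_cases hcx : c = x
        · subst hcx; exact Or.inr (Or.inl hcd.reachable)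
        · obtain ⟨e, he, hce⟩ := exists_edge_of_mem_openCluster ends hc hcx
          rcases hsep e he i hi2 c hce hci with h | h
          · exact absurd h hcx
          · subst h
            exact Or.inr (Or.inr ⟨Or.inl hc, Or.inr hcd.reachable⟩)
      · exact Or.inr (Or.inl (SimpleGraph.Reachable.trans hc hcd.reachable))
      · rcases hc with hc | hc
        · by_cases hcz : c = z
          · subst hcz; exact Or.inr (Or.inr ⟨hz, Or.inr hcd.reachable⟩)
          · obtain ⟨e, he, hce⟩ := exists_edge_of_mem_openCluster ends hc hcz
            rcases hsep e he i hi2 c hce hci with h | h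
            · subst h; exact Or.inr (Or.inl hcd.reachable)
            · exact absurd h hcz
        · exact Or.inr (Or.inr ⟨hz, Or.inr (SimpleGraph.Reachable.trans hc hcd.reachable)⟩)
    have hcl : ∀ c ∈ W, ∀ d, (openGraph (ends '' (↑(s₁ ∪ s₂) : Set ι))).Adj c d → d ∈ W := by
      intro c hc d hcd
      rw [openGraph_image_adj] at hcd
      obtain ⟨⟨i, hi12, hi⟩, hne⟩ := hcd
      rcases Finset.mem_union.mp hi12 with hi1 | hi2
      · exact step1 c d hc (by rw [openGraph_image_adj]; exact ⟨⟨i, hi1, hi⟩, hne⟩)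
      · exact step2 c d hc (by rw [openGraph_image_adj]; exact ⟨⟨i, hi2, hi⟩, hne⟩)
    have hsub := openCluster_subset_of_adjClosed ends x (↑(s₁ ∪ s₂) : Set ι) W hxW hcl
    exact hsub hy
  · rintro (hy | hy | ⟨hz, hy⟩)
    · exact mono1 hy
    · exact mono2 hy
    · have hz' : z ∈ openCluster (ends '' (↑(s₁ ∪ s₂) : Set ι)) x := by
        rcases hz with hz | hz
        · exact mono1 hz
        · exact mono2 hz
      have hy' : y ∈ openCluster (ends '' (↑(s₁ ∪ s₂) : Set ι)) z := by
        rcases hy with hy | hy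
        · exact mono1 hy
        · exact mono2 hy
      exact SimpleGraph.Reachable.trans hz' hy'



end Coefficientwise

end Summit.CriticalPhenomena.PercolationContinuityZ3.Theorems
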